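import Mathlib
import Summits.Ventures.PercRepro2.HalfLA2BMassesA
import Summits.Ventures.PercRepro2.HalfLA12Poly

/-!
# The masses of the `L`-half for `a₃ ~ {a₁, a₂}` (blind cell PercRepro2, night-1 g37)

`a₃` adjacent exactly to the two roots (`CaseOne.IsTwoMarkAt ends a₁ a₂ a₃ e₁ e₂`): with `e₁` open `a₃ ∈ L`,
with `e₂` open `a₃ ∈ H`, with both open `Q` fails.  The masses are the polynomials of `HalfLA12Poly` in the
cells `HalfLA2B.cells10Of` (the `NN` split is idle here).
-/

namespace Summit.Ventures.PercRepro2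

namespace HalfLA12

open CaseOne HalfLTwoMark HalfLA2B

section Masses

variable {V : Type*} {E : Type*} [Fintype E] [DecidableEq E] {R : Type*} [CommRing R]
variable {ends : E → Sym2 V} {o a₃ b : V} {e₁ e₂ : E}

/-- The ten cells (the `Cells10` of `HalfLA12Poly` from the base probabilities of `HalfLA2B.cells10Of`). -/
noncomputable def cellsA12 (p : E → R) (ends : E → Sym2 V) (o a₁ a₂ b : V) (e₁ e₂ : E) : Cells10 R :=
  ⟨(cells10Of p ends o a₁ a₂ b e₁ e₂).LL, (cells10Of p ends o a₁ a₂ b e₁ e₂).LH,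
    (cells10Of p ends o a₁ a₂ b e₁ e₂).LN, (cells10Of p ends o a₁ a₂ b e₁ e₂).HL,
    (cells10Of p ends o a₁ a₂ b e₁ e₂).HH, (cells10Of p ends o a₁ a₂ b e₁ e₂).HN,
    (cells10Of p ends o a₁ a₂ b e₁ e₂).NL, (cells10Of p ends o a₁ a₂ b e₁ e₂).NH,
    (cells10Of p ends o a₁ a₂ b e₁ e₂).NNs, (cells10Of p ends o a₁ a₂ b e₁ e₂).NNd⟩


/-- **`P(Q)`** for `a₃ ~ {a₁, a₂}`. -/
theorem mass_Q (p : E → R) {a₁ a₂ : V} (h : IsTwoMarkAt ends a₁ a₂ a₃ e₁ e₂) (_ho3 : o ≠ a₃)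
    (_hb3 : b ≠ a₃) :
    prob p ((connEvent ends a₁ a₂)ᶜ) =
      mQ (p e₁) (p e₂) (cellsA12 p ends o a₁ a₂ b e₁ e₂) := by
  set p00 := Function.update (Function.update p e₁ 0) e₂ 0 with hp00
  have h1 : a₁ ≠ a₃ := h.ne_o
  have h2 : a₂ ≠ a₃ := h.ne_b
  have key := prob_twoPin p h.ne ((connEvent ends a₁ a₂)ᶜ)
    (∅)
    ((connEvent ends a₁ a₂)ᶜ)
    ((connEvent ends a₁ a₂)ᶜ)
    ((connEvent ends a₁ a₂)ᶜ) ?_ ?_ ?_ ?_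
  · rw [key]
    unfold mQ cellsA12 cells10Of
    dsimp only
    rw [← hp00, prob_empty]
    have tot := total_cells p00 ends o b a₁ a₂
    have nn := split_NN p00 ends o a₁ a₂ b
    linear_combination (1 - p e₁ * p e₂) * (tot + nn)
  · intro ω ho hb
    rw [openCC_tt ho hb]
    simp only [Set.mem_compl_iff, mem_connEvent, Set.mem_empty_iff_false, iff_false]
    rw [conn_both_iff h ω h1 h2,
      base2_eq_self ho hb]
    have h11 := conn_refl ends ω a₁
    have h22 := conn_refl ends ω a₂
    tauto
  · intro ω ho hb
    rw [openCC_tf h.ne ho hb]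
    simp only [Set.mem_compl_iff, mem_connEvent]
    rw [conn_open_o_iff h ω h1 h2, base2_eq_self ho hb]

  · intro ω ho hb
    rw [openCC_ft ho hb]
    simp only [Set.mem_compl_iff, mem_connEvent]
    rw [conn_open_b_iff h ω h1 h2, base2_eq_self ho hb]

  · intro ω ho hb
    rw [openCC_ff ho hb, base2_eq_self ho hb]


/-- **`P(Q, b ∈ L)`** for `a₃ ~ {a₁, a₂}`. -/
theorem mass_bL (p : E → R) {a₁ a₂ : V} (h : IsTwoMarkAt ends a₁ a₂ a₃ e₁ e₂) (_ho3 : o ≠ a₃)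
    (hb3 : b ≠ a₃) :
    prob p ((connEvent ends a₁ a₂)ᶜ ∩ connEvent ends a₁ b) =
      mbL (p e₁) (p e₂) (cellsA12 p ends o a₁ a₂ b e₁ e₂) := by
  set p00 := Function.update (Function.update p e₁ 0) e₂ 0 with hp00
  have h1 : a₁ ≠ a₃ := h.ne_o
  have h2 : a₂ ≠ a₃ := h.ne_b
  have key := prob_twoPin p h.ne ((connEvent ends a₁ a₂)ᶜ ∩ connEvent ends a₁ b)
    (∅)
    ((connEvent ends a₁ a₂)ᶜ ∩ connEvent ends a₁ b)
    ((connEvent ends a₁ a₂)ᶜ ∩ connEvent ends a₁ b)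
    ((connEvent ends a₁ a₂)ᶜ ∩ connEvent ends a₁ b) ?_ ?_ ?_ ?_
  · rw [key]
    unfold mbL cellsA12 cells10Of
    dsimp only
    rw [← hp00, prob_empty]
    have so := split_o p00 ends o a₁ a₂ (connEvent ends a₁ b)
    linear_combination (1 - p e₁ * p e₂) * so
  · intro ω ho hb
    rw [openCC_tt ho hb]
    simp only [Set.mem_compl_iff, Set.mem_inter_iff, mem_connEvent, Set.mem_empty_iff_false, iff_false]
    rw [conn_both_iff h ω h1 h2, conn_both_iff h ω h1 hb3,
      base2_eq_self ho hb]
    have h11 := conn_refl ends ω a₁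
    have h22 := conn_refl ends ω a₂
    tauto
  · intro ω ho hb
    rw [openCC_tf h.ne ho hb]
    simp only [Set.mem_compl_iff, Set.mem_inter_iff, mem_connEvent]
    rw [conn_open_o_iff h ω h1 h2, conn_open_o_iff h ω h1 hb3, base2_eq_self ho hb]

  · intro ω ho hb
    rw [openCC_ft ho hb]
    simp only [Set.mem_compl_iff, Set.mem_inter_iff, mem_connEvent]
    rw [conn_open_b_iff h ω h1 h2, conn_open_b_iff h ω h1 hb3, base2_eq_self ho hb]

  · intro ω ho hb
    rw [openCC_ff ho hb, base2_eq_self ho hb]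


/-- **`P(T)`** for `a₃ ~ {a₁, a₂}`. -/
theorem mass_T (p : E → R) {a₁ a₂ : V} (h : IsTwoMarkAt ends a₁ a₂ a₃ e₁ e₂) (_ho3 : o ≠ a₃)
    (_hb3 : b ≠ a₃) :
    prob p ((connEvent ends a₁ a₂)ᶜ ∩ connEvent ends a₂ a₃) =
      mT (p e₁) (p e₂) (cellsA12 p ends o a₁ a₂ b e₁ e₂) := by
  set p00 := Function.update (Function.update p e₁ 0) e₂ 0 with hp00
  have h1 : a₁ ≠ a₃ := h.ne_o
  have h2 : a₂ ≠ a₃ := h.ne_b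
  have key := prob_twoPin p h.ne ((connEvent ends a₁ a₂)ᶜ ∩ connEvent ends a₂ a₃)
    (∅)
    (∅)
    ((connEvent ends a₁ a₂)ᶜ)
    (∅) ?_ ?_ ?_ ?_
  · rw [key]
    unfold mT cellsA12 cells10Of
    dsimp only
    rw [← hp00, prob_empty]
    have tot := total_cells p00 ends o b a₁ a₂
    have nn := split_NN p00 ends o a₁ a₂ b
    linear_combination ((1 - p e₁) * p e₂) * (tot + nn)
  · intro ω ho hb
    rw [openCC_tt ho hb]
    simp only [Set.mem_compl_iff, Set.mem_inter_iff, mem_connEvent, Set.mem_empty_iff_false, iff_false]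
    rw [conn_both_iff h ω h1 h2, conn_both_a3_iff h ω h2,
      base2_eq_self ho hb]
    simp only [conn_comm_iff ω a₂ a₁]
    have h11 := conn_refl ends ω a₁
    have h22 := conn_refl ends ω a₂
    tauto
  · intro ω ho hb
    rw [openCC_tf h.ne ho hb]
    simp only [Set.mem_compl_iff, Set.mem_inter_iff, mem_connEvent, Set.mem_empty_iff_false, iff_false]
    rw [conn_open_o_iff h ω h1 h2, conn_open_o_a3_iff h ω h2, base2_eq_self ho hb]
    simp only [conn_comm_iff ω a₂ a₁]
    tauto
  · intro ω ho hb
    rw [openCC_ft ho hb]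
    simp only [Set.mem_compl_iff, Set.mem_inter_iff, mem_connEvent]
    rw [conn_open_b_iff h ω h1 h2, conn_open_b_a3_iff h ω h2, base2_eq_self ho hb]
    have h22 := conn_refl ends ω a₂
    tauto
  · intro ω ho hb
    rw [openCC_ff ho hb]
    simp only [Set.mem_compl_iff, Set.mem_inter_iff, mem_connEvent, Set.mem_empty_iff_false, iff_false]
    exact fun hc => not_conn_base2 h ω h2 hc.2


/-- **`P(T, b ∈ L)`** for `a₃ ~ {a₁, a₂}`. -/
theorem mass_TbL (p : E → R) {a₁ a₂ : V} (h : IsTwoMarkAt ends a₁ a₂ a₃ e₁ e₂) (_ho3 : o ≠ a₃)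
    (hb3 : b ≠ a₃) :
    prob p ((connEvent ends a₁ a₂)ᶜ ∩ connEvent ends a₂ a₃ ∩ connEvent ends a₁ b) =
      mTbL (p e₁) (p e₂) (cellsA12 p ends o a₁ a₂ b e₁ e₂) := by
  set p00 := Function.update (Function.update p e₁ 0) e₂ 0 with hp00
  have h1 : a₁ ≠ a₃ := h.ne_o
  have h2 : a₂ ≠ a₃ := h.ne_b
  have key := prob_twoPin p h.ne ((connEvent ends a₁ a₂)ᶜ ∩ connEvent ends a₂ a₃ ∩ connEvent ends a₁ b)
    (∅)
    (∅)
    ((connEvent ends a₁ a₂)ᶜ ∩ connEvent ends a₁ b)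
    (∅) ?_ ?_ ?_ ?_
  · rw [key]
    unfold mTbL cellsA12 cells10Of
    dsimp only
    rw [← hp00, prob_empty]
    have so := split_o p00 ends o a₁ a₂ (connEvent ends a₁ b)
    linear_combination ((1 - p e₁) * p e₂) * so
  · intro ω ho hb
    rw [openCC_tt ho hb]
    simp only [Set.mem_compl_iff, Set.mem_inter_iff, mem_connEvent, Set.mem_empty_iff_false, iff_false]
    rw [conn_both_iff h ω h1 h2, conn_both_iff h ω h1 hb3, conn_both_a3_iff h ω h2,
      base2_eq_self ho hb]
    simp only [conn_comm_iff ω a₂ a₁]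
    have h11 := conn_refl ends ω a₁
    have h22 := conn_refl ends ω a₂
    intro hc
    have hc1 := hc.1
    clear hc
    tauto
  · intro ω ho hb
    rw [openCC_tf h.ne ho hb]
    simp only [Set.mem_compl_iff, Set.mem_inter_iff, mem_connEvent, Set.mem_empty_iff_false, iff_false]
    rw [conn_open_o_iff h ω h1 h2, conn_open_o_iff h ω h1 hb3, conn_open_o_a3_iff h ω h2, base2_eq_self ho hb]
    simp only [conn_comm_iff ω a₂ a₁]
    intro hc
    have hc1 := hc.1
    clear hc
    tauto
  · intro ω ho hb
    rw [openCC_ft ho hb]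
    simp only [Set.mem_compl_iff, Set.mem_inter_iff, mem_connEvent]
    rw [conn_open_b_iff h ω h1 h2, conn_open_b_iff h ω h1 hb3, conn_open_b_a3_iff h ω h2, base2_eq_self ho hb]
    have h22 := conn_refl ends ω a₂
    tauto
  · intro ω ho hb
    rw [openCC_ff ho hb]
    simp only [Set.mem_compl_iff, Set.mem_inter_iff, mem_connEvent, Set.mem_empty_iff_false, iff_false]
    exact fun hc => not_conn_base2 h ω h2 hc.1.2


/-- **`P(T, b ∈ L, o ∈ U)`** for `a₃ ~ {a₁, a₂}`. -/
theorem mass_TbLoU (p : E → R) {a₁ a₂ : V} (h : IsTwoMarkAt ends a₁ a₂ a₃ e₁ e₂) (ho3 : o ≠ a₃)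
    (hb3 : b ≠ a₃) :
    prob p ((connEvent ends a₁ a₂)ᶜ ∩ connEvent ends a₂ a₃ ∩ connEvent ends a₁ b ∩ (connEvent ends a₁ o ∪ connEvent ends a₂ o)) =
      mTbLoU (p e₁) (p e₂) (cellsA12 p ends o a₁ a₂ b e₁ e₂) := by
  set p00 := Function.update (Function.update p e₁ 0) e₂ 0 with hp00
  have h1 : a₁ ≠ a₃ := h.ne_o
  have h2 : a₂ ≠ a₃ := h.ne_b
  have key := prob_twoPin p h.ne ((connEvent ends a₁ a₂)ᶜ ∩ connEvent ends a₂ a₃ ∩ connEvent ends a₁ b ∩ (connEvent ends a₁ o ∪ connEvent ends a₂ o))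
    (∅)
    (∅)
    (((connEvent ends a₁ a₂)ᶜ ∩ connEvent ends a₁ o ∩ connEvent ends a₁ b) ∪ ((connEvent ends a₁ a₂)ᶜ ∩ connEvent ends a₂ o ∩ connEvent ends a₁ b))
    (∅) ?_ ?_ ?_ ?_
  · rw [key]
    unfold mTbLoU cellsA12 cells10Of
    dsimp only
    rw [← hp00, prob_empty]
    have d : Disjoint ((connEvent ends a₁ a₂)ᶜ ∩ connEvent ends a₁ o ∩ connEvent ends a₁ b) ((connEvent ends a₁ a₂)ᶜ ∩ connEvent ends a₂ o ∩ connEvent ends a₁ b) :=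
      Set.disjoint_left.2 fun ω h1 h2 => not_both h1.1.1 h1.1.2 h2.1.2
    rw [prob_union_of_disjoint p00 d]
    ring
  · intro ω ho hb
    rw [openCC_tt ho hb]
    simp only [Set.mem_compl_iff, Set.mem_inter_iff, Set.mem_union, mem_connEvent, Set.mem_empty_iff_false, iff_false]
    rw [conn_both_iff h ω h1 h2, conn_both_iff h ω h1 hb3, conn_both_a3_iff h ω h2,
      base2_eq_self ho hb]
    simp only [conn_comm_iff ω a₂ a₁]
    have h11 := conn_refl ends ω a₁
    have h22 := conn_refl ends ω a₂
    intro hc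
    have hc1 := hc.1.1
    clear hc
    tauto
  · intro ω ho hb
    rw [openCC_tf h.ne ho hb]
    simp only [Set.mem_compl_iff, Set.mem_inter_iff, Set.mem_union, mem_connEvent, Set.mem_empty_iff_false, iff_false]
    rw [conn_open_o_iff h ω h1 h2, conn_open_o_iff h ω h1 hb3, conn_open_o_a3_iff h ω h2, base2_eq_self ho hb]
    simp only [conn_comm_iff ω a₂ a₁]
    intro hc
    have hc1 := hc.1.1
    clear hc
    tauto
  · intro ω ho hb
    rw [openCC_ft ho hb]
    simp only [Set.mem_compl_iff, Set.mem_inter_iff, Set.mem_union, mem_connEvent]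
    rw [conn_open_b_iff h ω h1 h2, conn_open_b_iff h ω h1 hb3, conn_open_b_iff h ω h1 ho3, conn_open_b_iff h ω h2 ho3, conn_open_b_a3_iff h ω h2, base2_eq_self ho hb]
    have h22 := conn_refl ends ω a₂
    tauto
  · intro ω ho hb
    rw [openCC_ff ho hb]
    simp only [Set.mem_compl_iff, Set.mem_inter_iff, Set.mem_union, mem_connEvent, Set.mem_empty_iff_false, iff_false]
    exact fun hc => not_conn_base2 h ω h2 hc.1.1.2


end Masses

end HalfLA12

end Summit.Ventures.PercRepro2
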